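import Literature.Probability.LatticeModels.GinibreBondDecoupling
import Literature.Probability.LatticeModels.GinibreInequalityFiniteSqrtExtension
import HarnessLib

/-!
# One-bond decoupling for Ginibre systems on finite abelian groups with a square-root extension
# (`ℤ_p` variables of EVERY order `p`)

Companion of `GinibreBondDecoupling.lean`. There the ONE-BOND DECOUPLING INEQUALITY of
Tomboulis–Ukawa–Windey 1981 / Sá Barreto–O'Carroll 1983 (in the abelian-variable form of
Mota–Sá Barreto 2024 §2 eq. (3)),

  `⟨Re χ₀⟩_{J|S→0} = 0  ⟹  ⟨Re χ₀⟩_J ≤ ∑_{a ∈ S} Jₐ · ½ (⟨Re(χ₀ χₐ)⟩_J + ⟨Re(χ₀ χₐ⁻¹)⟩_J)`,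

is proved for Gibbs measures `⟨·⟩_J ∝ exp(∑ₐ Jₐ Re χₐ) dμ`, `Jₐ ≥ 0`, on a compact abelian group `Ω` in
which EVERY ELEMENT IS A SQUARE — the hypothesis of the tree's Ginibre comparison inequality
`ginibreExpect_reChar_mono` (tori, `ℤ_n` with `n` odd). The present file removes that hypothesis for
FINITE groups: it suffices that `Ω` embeds, `j : Ω ↪ Ω̃`, into a finite abelian group in which every
`j ω` is a square, the interaction characters and the observed character being restrictions `χ̃ ∘ j` of
characters of `Ω̃` (`ginibreExpect_reChar_le_sum_decouple_of_sqrtExt`). This is exactly the setting of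
Ginibre's discrete Example 4 (Ginibre 1970 §2, p. 316–317: cyclic groups `ℤ_p` of ANY order, through
the parity decomposition), typed in the tree as `GinibreSqrtExt.ginibreExpect_reChar_mono_of_sqrtExt`
/ `ginibreExpect_reChar_nonneg_of_sqrtExt` (`GinibreInequalityFiniteSqrtExtension.lean`); the model case
is `Ω = ℤ_n^E ⊂ Ω̃ = ℤ_{2n}^E` — the configurations of a `ℤ_n` lattice gauge theory or clock model with
`n` EVEN (`ℤ₂`, `ℤ₄`, …), for which squaring is not onto.

Proof: the printed one (as in `GinibreBondDecoupling.lean`), with the two Griffiths–Ginibre inputs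
taken through the extension — along the coupling path `t ↦ J_t` (`cplAt J S t`, the couplings of `S`
multiplied by `t ∈ [0,1]`) the fluctuation formula `d/dt ⟨Re χ₀⟩_t = ⟨Re χ₀ · H_S⟩_t − ⟨Re χ₀⟩_t⟨H_S⟩_t`
(tree `hasDerivAt_ginibreExpect_cplAt`, Ginibre 1970 (1.7)–(1.8)) is bounded by
`∑_{a∈S} Jₐ ½(⟨Re(χ₀χₐ)⟩_t + ⟨Re(χ₀χ̄ₐ)⟩_t)` using Griffiths' first inequality
(`ginibreExpect_reChar_nonneg_of_sqrtExt`: the subtracted product is `≥ 0`) and then by the same at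
`t = 1` using Griffiths' second inequality in Ginibre's monotone form
(`ginibreExpect_reChar_mono_of_sqrtExt`); the mean value inequality on `[0,1]` and `⟨Re χ₀⟩_0 = 0`
finish.

## Main results (sorry-free, no new facts)

* `GinibreSqrtExt.ginibreExpect_reChar_le_sum_decouple_of_sqrtExt` — the decoupling inequality for
  general couplings `J ≥ 0`;
* `GinibreSqrtExt.ginibreExpect_reChar_le_mul_sum_decouple_of_sqrtExt` — uniform coupling `β ≥ 0`
  (the printed `⟨W(C)⟩ ≤ β ∑_{P ∋ b} ⟨W(C) χ_P⟩`).

Use: the strong-coupling area law of `ℤ_n` lattice gauge theory for EVEN `n`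
(`Literature.MathematicalPhysics.QuantumFieldTheory.ZnAreaLawGinibreAllN`). HONEST LABEL: a
finite-volume correlation inequality; nothing here bears on the Yang–Mills mass gap.

## References

* [Ginibre1970] J. Ginibre, General formulation of Griffiths' inequalities, Commun. Math. Phys. 16
  (1970) 310–328 — §1 (1.7)–(1.8), Props. 2–3, §2 Example 4 (discrete case p. 316–317), Model 3.
* [MotaSaBarreto2024] A. L. Mota, F. C. Sá Barreto, arXiv:2402.12277, §2 eq. (3).
* [TomboulisUkawaWindey1981] E. T. Tomboulis, A. Ukawa, P. Windey, Nucl. Phys. B 180 (1981) 294.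
-/

noncomputable section

open MeasureTheory Filter Finset
open scoped Topology

namespace Literature.Probability.LatticeModels

namespace GinibreSqrtExt

variable {Ω : Type*} [CommGroup Ω] [Finite Ω] [TopologicalSpace Ω] [DiscreteTopology Ω]
  [MeasurableSpace Ω] [BorelSpace Ω] {Ωt : Type*} [CommGroup Ωt] [Finite Ωt] [TopologicalSpace Ωt]
  {ι : Type*} [Fintype ι] [DecidableEq ι]

omit [Finite Ω] [DiscreteTopology Ω] [MeasurableSpace Ω] [BorelSpace Ω] in
/-- `Re χ₀ · Re χ₁ = ½ (Re(χ₀χ₁) + Re(χ₀χ₁⁻¹))` (product-to-sum for unitary characters).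
[folklore] -/
private theorem reChar_mul_reChar' (χ₀ χ₁ : Ω →ₜ* Circle) (θ : Ω) :
    reChar χ₀ θ * reChar χ₁ θ = (reChar (χ₀ * χ₁) θ + reChar (χ₀ * χ₁⁻¹) θ) / 2 := by
  have hmul : (χ₀ * χ₁) θ = χ₀ θ * χ₁ θ := rfl
  have hinv : (χ₀ * χ₁⁻¹) θ = χ₀ θ * (χ₁ θ)⁻¹ := rfl
  simp only [reChar, hmul, hinv, Circle.coe_mul, Circle.coe_inv_eq_conj, Complex.mul_re, Complex.conj_re,
    Complex.conj_im]
  ring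

/-- **ONE-BOND DECOUPLING THROUGH A SQUARE-ROOT EXTENSION** (Tomboulis–Ukawa–Windey 1981 /
Sá Barreto–O'Carroll 1983 in the form of Mota–Sá Barreto 2024 §2 eq. (3), for Ginibre systems on
finite abelian groups; Ginibre 1970 §2 Example 4, discrete case `ℤ_p` of any order). Let `Ω` be a
finite abelian group with a left-invariant (Haar, uniform) probability measure `μ`, `j : Ω → Ω̃` an
injective homomorphism into a finite abelian group such that every `j ω` is a square in `Ω̃`, and
let the interaction characters `χₐ = χ̃ₐ ∘ j` and the observed character `χ₀ = χ̃₀ ∘ j` be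
restrictions of unitary characters of `Ω̃`. If the couplings are ferromagnetic, `Jₐ ≥ 0`, and
switching off the couplings of the terms in `S` kills `χ₀`, `⟨Re χ₀⟩_{J|S→0} = 0`, then

  `⟨Re χ₀⟩_J ≤ ∑_{a ∈ S} Jₐ · (⟨Re(χ₀χₐ)⟩_J + ⟨Re(χ₀χₐ⁻¹)⟩_J) / 2`.

(Every element a square: the tree's `ginibreExpect_reChar_le_sum_decouple`; here e.g.
`Ω = ℤ_n^E ⊂ ℤ_{2n}^E`, `n` even.) Proof as printed: the fluctuation formula for `d/dt ⟨Re χ₀⟩_{J_t}`,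
Griffiths' first inequality and Ginibre's comparison inequality through the extension, and the mean
value inequality on `[0, 1]`. [cite: MotaSaBarreto2024, §2 eq. (3)] [cite: Ginibre1970, §2 Example 4 (discrete case, p. 316–317) with Props. 2–3] -/
theorem ginibreExpect_reChar_le_sum_decouple_of_sqrtExt (μ : Measure Ω) [IsProbabilityMeasure μ]
    [μ.IsMulLeftInvariant] (j : Ω →* Ωt) (hj : Function.Injective j)
    (hsq : ∀ ω : Ω, ∃ s : Ωt, s * s = j ω) (χ : ι → Ω →ₜ* Circle) (χt : ι → Ωt →ₜ* Circle)
    (hχ : ∀ a θ, χ a θ = χt a (j θ)) {J : ι → ℝ} (hJ : ∀ a, 0 ≤ J a) (S : Finset ι)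
    (χ₀ : Ω →ₜ* Circle) (χt₀ : Ωt →ₜ* Circle) (hχ₀ : ∀ θ, χ₀ θ = χt₀ (j θ))
    (h0 : ginibreExpect μ χ (cplOff J S) (reChar χ₀) = 0) :
    ginibreExpect μ χ J (reChar χ₀) ≤ ∑ a ∈ S, J a *
      ((ginibreExpect μ χ J (reChar (χ₀ * χ a)) + ginibreExpect μ χ J (reChar (χ₀ * (χ a)⁻¹))) / 2) := by
  set M : ℝ := ∑ a ∈ S, J a *
    ((ginibreExpect μ χ J (reChar (χ₀ * χ a)) + ginibreExpect μ χ J (reChar (χ₀ * (χ a)⁻¹))) / 2) with hM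
  set Φ : ℝ → ℝ := fun t => ginibreExpect μ χ (cplAt J S t) (reChar χ₀) with hΦ
  set Φ' : ℝ → ℝ := fun t =>
    ginibreExpect μ χ (cplAt J S t) (fun θ => reChar χ₀ θ * ginibreHamiltonian χ (cplOn J S) θ) -
      ginibreExpect μ χ (cplAt J S t) (reChar χ₀) *
        ginibreExpect μ χ (cplAt J S t) (ginibreHamiltonian χ (cplOn J S)) with hΦ'
  have hder : ∀ t, HasDerivAt Φ (Φ' t) t := fun t =>
    hasDerivAt_ginibreExpect_cplAt μ χ J S (continuous_reChar χ₀) t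
  have hOn : ∀ a, 0 ≤ cplOn J S a := fun a => by
    unfold cplOn; split_ifs; exacts [hJ a, le_rfl]
  -- the shifted characters `χ₀χₐ`, `χ₀χₐ⁻¹` are again restrictions from `Ω̃`
  have hχmul : ∀ a θ, (χ₀ * χ a) θ = (χt₀ * χt a) (j θ) := fun a θ => by
    change χ₀ θ * χ a θ = χt₀ (j θ) * χt a (j θ)
    rw [hχ₀, hχ]
  have hχinv : ∀ a θ, (χ₀ * (χ a)⁻¹) θ = (χt₀ * (χt a)⁻¹) (j θ) := fun a θ => by
    change χ₀ θ * (χ a θ)⁻¹ = χt₀ (j θ) * (χt a (j θ))⁻¹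
    rw [hχ₀, hχ]
  -- the derivative is bounded by `M` on `[0, 1]`
  have hbound : ∀ t, 0 ≤ t → t ≤ 1 → Φ' t ≤ M := by
    intro t ht0 ht1
    have hKt : ∀ a, 0 ≤ cplAt J S t a := fun a =>
      cplAt_nonneg Finset.univ J S (fun a _ => hJ a) ht0 a (Finset.mem_univ a)
    have hKle : ∀ a, cplAt J S t a ≤ J a := fun a =>
      le_of_abs_le (abs_cplAt_le Finset.univ J S (fun a _ => hJ a) ht0 ht1 a (Finset.mem_univ a))
    have hG : ginibreExpect μ χ (cplAt J S t) (ginibreHamiltonian χ (cplOn J S)) =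
        ∑ a, cplOn J S a * ginibreExpect μ χ (cplAt J S t) (reChar (χ a)) := by
      rw [← ginibreExpect_sum_mul μ χ (cplAt J S t) Finset.univ (cplOn J S) fun a => continuous_reChar (χ a)]
      rfl
    have hprod : 0 ≤ ginibreExpect μ χ (cplAt J S t) (reChar χ₀) *
        ginibreExpect μ χ (cplAt J S t) (ginibreHamiltonian χ (cplOn J S)) := by
      refine mul_nonneg (ginibreExpect_reChar_nonneg_of_sqrtExt μ j hj hsq χ χ₀ χt χt₀ hχ hχ₀ hKt) ?_
      rw [hG]
      exact Finset.sum_nonneg fun a _ => mul_nonneg (hOn a)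
        (ginibreExpect_reChar_nonneg_of_sqrtExt μ j hj hsq χ (χ a) χt (χt a) hχ (hχ a) hKt)
    have hE1 : ginibreExpect μ χ (cplAt J S t) (fun θ => reChar χ₀ θ * ginibreHamiltonian χ (cplOn J S) θ) =
        ∑ a, cplOn J S a * ginibreExpect μ χ (cplAt J S t) (fun θ => reChar χ₀ θ * reChar (χ a) θ) := by
      rw [← ginibreExpect_sum_mul μ χ (cplAt J S t) Finset.univ (cplOn J S)
        (g := fun a θ => reChar χ₀ θ * reChar (χ a) θ)
        fun a => (continuous_reChar χ₀).mul (continuous_reChar (χ a))]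
      congr 1
      funext θ
      rw [ginibreHamiltonian, Finset.mul_sum]
      exact Finset.sum_congr rfl fun a _ => by ring
    have hE2 : ∀ a, ginibreExpect μ χ (cplAt J S t) (fun θ => reChar χ₀ θ * reChar (χ a) θ) =
        (ginibreExpect μ χ (cplAt J S t) (reChar (χ₀ * χ a)) +
          ginibreExpect μ χ (cplAt J S t) (reChar (χ₀ * (χ a)⁻¹))) / 2 := by
      intro a
      have e : (fun θ => reChar χ₀ θ * reChar (χ a) θ) =
          fun θ => (1 / 2) * (reChar (χ₀ * χ a) θ + reChar (χ₀ * (χ a)⁻¹) θ) := by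
        funext θ; rw [reChar_mul_reChar']; ring
      rw [e, ginibreExpect_const_mul, ginibreExpect_add μ χ _ (continuous_reChar _) (continuous_reChar _)]
      ring
    have hmono₁ : ∀ a, ginibreExpect μ χ (cplAt J S t) (reChar (χ₀ * χ a)) ≤
        ginibreExpect μ χ J (reChar (χ₀ * χ a)) := fun a =>
      ginibreExpect_reChar_mono_of_sqrtExt μ j hj hsq χ (χ₀ * χ a) χt (χt₀ * χt a) hχ (hχmul a) hKt hKle
    have hmono₂ : ∀ a, ginibreExpect μ χ (cplAt J S t) (reChar (χ₀ * (χ a)⁻¹)) ≤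
        ginibreExpect μ χ J (reChar (χ₀ * (χ a)⁻¹)) := fun a =>
      ginibreExpect_reChar_mono_of_sqrtExt μ j hj hsq χ (χ₀ * (χ a)⁻¹) χt (χt₀ * (χt a)⁻¹) hχ (hχinv a)
        hKt hKle
    calc Φ' t ≤ ginibreExpect μ χ (cplAt J S t) (fun θ => reChar χ₀ θ * ginibreHamiltonian χ (cplOn J S) θ) :=
          sub_le_self _ hprod
      _ = ∑ a, cplOn J S a * ((ginibreExpect μ χ (cplAt J S t) (reChar (χ₀ * χ a)) +
            ginibreExpect μ χ (cplAt J S t) (reChar (χ₀ * (χ a)⁻¹))) / 2) := by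
          rw [hE1]
          exact Finset.sum_congr rfl fun a _ => by rw [hE2]
      _ ≤ ∑ a, cplOn J S a * ((ginibreExpect μ χ J (reChar (χ₀ * χ a)) +
            ginibreExpect μ χ J (reChar (χ₀ * (χ a)⁻¹))) / 2) := by
          refine Finset.sum_le_sum fun a _ => mul_le_mul_of_nonneg_left ?_ (hOn a)
          have h₁ := hmono₁ a
          have h₂ := hmono₂ a
          linarith
      _ = M := by
          rw [hM]
          have e : ∀ a, cplOn J S a * ((ginibreExpect μ χ J (reChar (χ₀ * χ a)) +
              ginibreExpect μ χ J (reChar (χ₀ * (χ a)⁻¹))) / 2) =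
              if a ∈ S then J a * ((ginibreExpect μ χ J (reChar (χ₀ * χ a)) +
                ginibreExpect μ χ J (reChar (χ₀ * (χ a)⁻¹))) / 2) else 0 := fun a => by
            unfold cplOn; split_ifs <;> simp
          rw [Finset.sum_congr rfl fun a _ => e a, Finset.sum_ite_mem, Finset.univ_inter]
  -- mean value inequality on `[0, 1]`
  have hdiff : Differentiable ℝ Φ := fun t => (hder t).differentiableAt
  have hderiv_le : ∀ t ∈ interior (Set.Icc (0 : ℝ) 1), deriv Φ t ≤ M := by
    intro t ht
    rw [interior_Icc] at ht
    rw [(hder t).deriv]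
    exact hbound t ht.1.le ht.2.le
  have hmvt := (convex_Icc (0 : ℝ) 1).image_sub_le_mul_sub_of_deriv_le hdiff.continuous.continuousOn
    hdiff.differentiableOn hderiv_le 0 (Set.left_mem_Icc.2 zero_le_one) 1
    (Set.right_mem_Icc.2 zero_le_one) zero_le_one
  have h1 : Φ 1 = ginibreExpect μ χ J (reChar χ₀) := by simp only [hΦ, cplAt_one]
  have h0' : Φ 0 = 0 := by simp only [hΦ, cplAt_zero]; exact h0
  rw [h1, h0'] at hmvt
  norm_num at hmvt
  exact hmvt

/-- The decoupling inequality through a square-root extension for a **uniform** coupling `β ≥ 0`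
(the printed form `⟨W(C)⟩ ≤ β ∑_{P ∋ b} ⟨W(C) χ_P⟩`, abelian variables of any finite order):
`⟨Re χ₀⟩_β ≤ β ∑_{a∈S} (⟨Re(χ₀χₐ)⟩_β + ⟨Re(χ₀χₐ⁻¹)⟩_β)/2`. [cite: MotaSaBarreto2024, §2 eq. (3)] -/
theorem ginibreExpect_reChar_le_mul_sum_decouple_of_sqrtExt (μ : Measure Ω) [IsProbabilityMeasure μ]
    [μ.IsMulLeftInvariant] (j : Ω →* Ωt) (hj : Function.Injective j)
    (hsq : ∀ ω : Ω, ∃ s : Ωt, s * s = j ω) (χ : ι → Ω →ₜ* Circle) (χt : ι → Ωt →ₜ* Circle)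
    (hχ : ∀ a θ, χ a θ = χt a (j θ)) {β : ℝ} (hβ : 0 ≤ β) (S : Finset ι)
    (χ₀ : Ω →ₜ* Circle) (χt₀ : Ωt →ₜ* Circle) (hχ₀ : ∀ θ, χ₀ θ = χt₀ (j θ))
    (h0 : ginibreExpect μ χ (cplOff (fun _ => β) S) (reChar χ₀) = 0) :
    ginibreExpect μ χ (fun _ => β) (reChar χ₀) ≤ β * ∑ a ∈ S,
      (ginibreExpect μ χ (fun _ => β) (reChar (χ₀ * χ a)) +
        ginibreExpect μ χ (fun _ => β) (reChar (χ₀ * (χ a)⁻¹))) / 2 := by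
  rw [Finset.mul_sum]
  exact ginibreExpect_reChar_le_sum_decouple_of_sqrtExt μ j hj hsq χ χt hχ (fun _ => hβ) S χ₀ χt₀ hχ₀ h0

end GinibreSqrtExt

end Literature.Probability.LatticeModels

end
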